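import Summits.ResolutionOfSingularities.ResolutionOfSingularities.Theses.TeissierJung
import Summits.ResolutionOfSingularities.ResolutionOfSingularities.Theorems.PAlterationPicoverLocalModelModificationTransfer
import Literature.AlgebraicGeometry.Resolution.TeissierPresentation
import HarnessLib

/-!
# Crux `TeissierReduction` (stmt-ResolutionOfSingularities-17085, route `TeissierJung`):
# the JUNG-SQUARE TRANSFER — a Teissier-presented base change of `H` along a modification of the
# base of a dominant projection witnesses the crux

The intended mechanism of the crux (Mourtada–Schober 2025 p. 4, after Jung; Piltant 2003 "blow up
only the base") is: project the hypersurface `H` finitely (hence dominantly) onto a regular base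
`B = ℙ^d`, modify ONLY the base by a proper birational `σ : S → B`, and present the fibre product
`H ×_B S` over `S`. The typed crux only asks for SOME proper birational `X' → H` with `TF X'`
(`= TeissierPresented k X'`, bridge `teissierPresented_iff`). This file is the bookkeeping that
turns the former into the latter, so that a line built on the Jung square has a kernel-checked
composition and carries all its difficulty in ONE honest stub (making the pullback
Teissier-presented):

* `exists_teissierPresented_model_of_jungSquare` — if `π₀ : H → B` is dominant, `σ : S → B` is
  proper birational, and the fibre product `H ×_B S` is integral and Teissier-presented, then
  `pullback.fst : H ×_B S → H` is a proper (base change) birational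
  (`isBirational_pullback_fst`, in tree) morphism from a Teissier-presented scheme;
* `teissierReduction_of_jungSquares` — the crux `TeissierReduction` follows from the JUNG-SQUARE
  form of its conclusion for every integral hypersurface `H ⊆ ℙᵐ_k` (`k` algebraically closed of
  characteristic `p`): the transfer stub `C⁺ → C` of any Jung-type line.

Nothing here is specific to `ℙ^d`, to finiteness or flatness of `π₀`, or to local principality;
the open content (producing `σ` with `H ×_B S` Teissier-presented in dimension `≥ 4`) is untouched.
-/

-- single-problem summit: the doubled namespace component `ResolutionOfSingularities` is forced
set_option linter.dupNamespace false

noncomputable section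

open CategoryTheory CategoryTheory.Limits AlgebraicGeometry TopologicalSpace
open Literature.AlgebraicGeometry.Resolution
open Literature.AlgebraicGeometry.Motives (projectiveSpace)
open Summit.ResolutionOfSingularities.ResolutionOfSingularities.Theses.TeissierJung
open Summit.ResolutionOfSingularities.ResolutionOfSingularities.Theorems.PicoverLocalModel.ModificationTransfer
  (isBirational_pullback_fst)

namespace Summit.ResolutionOfSingularities.ResolutionOfSingularities.Theorems.TeissierReduction

/-- **Jung-square transfer (one square).** Let `π₀ : H → B` be a dominant morphism from an
integral scheme and `σ : S → B` a proper birational morphism. If the fibre product `H ×_B S` is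
integral and Teissier-presented over `k`, then `H` has a proper birational Teissier-presented
model, namely `pullback.fst π₀ σ : H ×_B S → H` (proper as a base change of `σ`; birational by
`isBirational_pullback_fst`: an isomorphism over `π₀⁻¹ U` when `σ` is one over the dense open
`U`, with dense preimage in the irreducible fibre product). [folklore] -/
theorem exists_teissierPresented_model_of_jungSquare {k : Type} [Field k] {H B S : Scheme.{0}}
    [IsIntegral H] (π₀ : H ⟶ B) [IsDominant π₀] (σ : S ⟶ B) [IsProper σ] (hσ : IsBirational σ)
    [IsIntegral ↑(pullback π₀ σ)] (hT : TeissierPresented k ↑(pullback π₀ σ)) :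
    ∃ (X' : Scheme.{0}) (ρ : X' ⟶ H), IsProper ρ ∧ IsBirational ρ ∧ TeissierPresented k X' :=
  ⟨pullback π₀ σ, pullback.fst π₀ σ, inferInstance, isBirational_pullback_fst π₀ σ hσ, hT⟩

/-- **The crux from Jung squares** (transfer stub `C⁺ → TeissierReduction` for Jung-type lines):
if for every prime `p`, every algebraically closed `k` of characteristic `p` and every integral
closed `H ⊆ ℙᵐ_k` with locally principal ideal there are a dominant `π₀ : H → B`, a proper
birational `σ : S → B` and a Teissier presentation of the integral fibre product `H ×_B S`, then
`TeissierReduction` holds (`exists_teissierPresented_model_of_jungSquare` at each `H`, and the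
bridge `teissierPresented_iff` to the let-bound predicate `TF`). [folklore] -/
theorem teissierReduction_of_jungSquares
    (hJ : ∀ p : ℕ, p.Prime → ∀ (k : Type) [Field k] [CharP k p] [IsAlgClosed k] (m : ℕ)
      (H : Scheme.{0}) (ι' : H ⟶ (projectiveSpace m k).left),
      IsClosedImmersion ι' → IsIntegral H →
      (∀ y : (projectiveSpace m k).left, ∃ U : (projectiveSpace m k).left.affineOpens,
        y ∈ (U : (projectiveSpace m k).left.Opens) ∧ (ι'.ker.ideal U).IsPrincipal) →
      ∃ (B S : Scheme.{0}) (π₀ : H ⟶ B) (σ : S ⟶ B), IsDominant π₀ ∧ IsProper σ ∧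
        IsBirational σ ∧ IsIntegral ↑(pullback π₀ σ) ∧ TeissierPresented k ↑(pullback π₀ σ)) :
    TeissierReduction := by
  intro p hp k _ _ _ TF m H ι' hι hH hprinc
  obtain ⟨B, S, π₀, σ, hdom, hσp, hσb, hint, hT⟩ := hJ p hp k m H ι' hι hH hprinc
  haveI := hH
  haveI := hdom
  haveI := hσp
  haveI := hint
  obtain ⟨X', ρ, h1, h2, h3⟩ := exists_teissierPresented_model_of_jungSquare (k := k) π₀ σ hσb hT
  exact ⟨X', ρ, h1, h2, (teissierPresented_iff k X').1 h3⟩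

end Summit.ResolutionOfSingularities.ResolutionOfSingularities.Theorems.TeissierReduction

end
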